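import Summits.PneNP.PneNP.Theorems.SoloInformedLinearLadderWlin
import HarnessLib

/-!
# The linear-time ladder, IV: the same exponent, and the first rung on the fixed witness

Soloist file (`solo-PneNP-informed`, summit-directed charter; landing prefix `SoloInformed`),
companion of `SoloInformedLinearLadderWlin.lean`.

* `soloInformed_NTIME_id_subset_DTIME_pow_of_Wlin_mem_DTIME` — the SAME-EXPONENT version
  `Wlin ∈ DTIME(nᵏ) → NTIME(n) ⊆ DTIME(nᵏ)` (`k ≥ 1`), hence each rung is witnessed by `Wlin`
  (`soloInformed_Wlin_not_mem_DTIME_pow_of_not_subset`) and the vendored PPST fact gives the first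
  rung on the fixed witness, `Wlin ∉ DTIME(n)` (`soloInformed_Wlin_not_mem_DTIME_id_of_paulEtAl1983`).

Nothing here is progress toward `P ≠ NP`; it is a kernel-checked SHARPENING OF THE SUMMIT STATEMENT:
`P ≠ NP` is `Wlin ∉ DTIME(nᵏ)` for every `k`, and exactly the rung `k = 1` is a theorem in print
(W. Paul, N. Pippenger, E. Szemerédi, W. Trotter, FOCS 1983, 429–438 [PaulEtAl1983], for multitape
machines; vendored in the tree as a named fact). References as in part II: S. Arora, B. Barak,
*Computational Complexity* (2009), Thm. 1.9 and §1.4.1 [AroraBarakCC2009]. Standard axioms only.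
-/

namespace Summit.PneNP.PneNP.Theorems

open Literature.Computability.Complexity _root_.Computability Turing Polynomial Brick SoloLinearLadder
open Literature.Computability.Complexity.UnaryClock

/-! ### Same-exponent version and the first rung on the fixed witness

For `k ≥ 1` the reduction to `Wlin` preserves the exponent exactly (its output has affine length and
it runs in linear time), so each rung `NTIME(n) ⊄ DTIME(nᵏ)` of the ladder is witnessed by the SAME
language: `NTIME(n) ⊄ DTIME(nᵏ) → Wlin ∉ DTIME(nᵏ)`. In particular the one proved rung, the
Paul–Pippenger–Szemerédi–Trotter theorem (vendored as the named fact
`PaulEtAl1983_NTIME_not_subset_DTIME`), gives `Wlin ∉ DTIME(n)`; `P ≠ NP` is `Wlin ∉ DTIME(nᵏ)` for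
every `k`. -/

namespace SoloLinearLadder

/-- Arithmetic of the decider at the same exponent `k ≥ 1`: clock + prefix writer + `nᵏ`-time
decider on an affine-length instance is `O(nᵏ)`. [folklore] -/
theorem ladder_arith_pos (a' K E a₂ C₁ k n P : ℕ) (hk : k ≠ 0) (hP : P ≤ C₁ * n ^ k + C₁) :
    a₂ * P + a₂ + (6 * (2 * n + 2 + (K * n + K)) + (2 * E + 2) + 3) + (a' * (K * n + K) + a') ≤
      (a' * K + a' + 6 * K + 2 * E + 17 + 2 * (a₂ * C₁) + a₂) * n ^ k +
        (a' * K + a' + 6 * K + 2 * E + 17 + 2 * (a₂ * C₁) + a₂) := by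
  set m := n ^ k
  have hn : n ≤ m := Nat.le_self_pow hk n
  have h1 : a' * (K * n + K) ≤ a' * (K * m) + a' * K := by
    rw [← Nat.mul_add]
    exact Nat.mul_le_mul_left _ (Nat.add_le_add_right (Nat.mul_le_mul_left _ hn) _)
  have h2 : K * n ≤ K * m := Nat.mul_le_mul_left _ hn
  have h3 : a₂ * P ≤ a₂ * (C₁ * m) + (a₂ * C₁ + a₂ * C₁) := by
    calc a₂ * P ≤ a₂ * (C₁ * m + C₁) := Nat.mul_le_mul_left _ hP
      _ = a₂ * (C₁ * m) + a₂ * C₁ := by ring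
      _ ≤ a₂ * (C₁ * m) + (a₂ * C₁ + a₂ * C₁) := by omega
  have e : (a' * K + a' + 6 * K + 2 * E + 17 + 2 * (a₂ * C₁) + a₂) * m =
      a' * (K * m) + a' * m + 6 * (K * m) + 2 * (E * m) + 17 * m +
        (a₂ * (C₁ * m) + a₂ * (C₁ * m)) + a₂ * m := by ring
  rw [e]
  omega

end SoloLinearLadder

/-- **Same exponent: `Wlin ∈ DTIME(nᵏ) ⟹ NTIME(n) ⊆ DTIME(nᵏ)` for `k ≥ 1`.** The proof is that of
`soloInformed_NTIME_id_subset_DTIME_pow_succ_of_Wlin_mem_DTIME` verbatim (truncating total verifier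
`M̃`, overhead `ClockedUA.pM M̃ = A·X`, instance `⟨code M̃, ⟨x, 1^{K|x|+K}⟩⟩` written by a linear unary
clock followed by a constant-prefix machine, completeness/soundness by `ClockedUA.complete/sound` and
`AvM.outputsWithin_unique`), with the final time bound read at exponent `k` instead of `k + 1`
(`SoloLinearLadder.ladder_arith_pos`, using `n ≤ nᵏ`). [cite: AroraBarakCC2009, Thm. 1.9 and §1.4.1] -/
theorem soloInformed_NTIME_id_subset_DTIME_pow_of_Wlin_mem_DTIME {k : ℕ} (hk : 1 ≤ k)
    (hW : Wlin ∈ DTIME (fun n => n ^ k)) :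
    NTIME (fun n => n) ⊆ DTIME (fun n => n ^ k) := by
  intro L hL
  obtain ⟨c, R, M, hM, hLR⟩ := hL
  dsimp only at hM hLR
  rcases Nat.eq_zero_or_pos c with rfl | hc
  · exact (not_outputsWithin_zero M _ _ (by simpa using hM [] [] (by simp))).elim
  -- (1) the truncating (total) verifier and its time
  obtain ⟨Nc, a, hNc⟩ := exists_linear_unaryClock hc
  obtain ⟨Mt, hMt⟩ : ∃ Mt : TM2ComputableAux Bool Bool, ∀ x y : List Bool,
      Mt.OutputsWithin (boolPair x y) (encodeBool (R x (y.take (c * x.length + c))))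
        (c * x.length + c + (a * (c * x.length + c) + a + 3 * x.length + 2 * (c * x.length + c) +
          2 * x.length + y.length / 2 + 11)) := by
    refine ⟨(truncMapAux Nc).comp M, fun x y => ?_⟩
    have h1 := outputsWithin_truncMapAux_boolPair Nc (y := y) (hNc x)
    rw [List.length_replicate] at h1
    exact Turing.TM2ComputableAux.comp_outputsWithin _ _ h1
      (hM x (y.take (c * x.length + c)) (List.length_take_le _ _))
  set D : ℕ := a * c + a + 4 * c + 16 with hD
  have hcD : c ≤ D := by omega
  have hMt_short : ∀ x y : List Bool, y.length ≤ c * x.length + c →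
      Mt.OutputsWithin (boolPair x y) (encodeBool (R x y)) (D * x.length + D) := by
    intro x y hy
    have h := hMt x y
    rw [List.take_of_length_le hy] at h
    exact h.mono (verifier_arith a c x.length y.length hy)
  -- (2) the overhead and the budget slope
  obtain ⟨A, hA⟩ : ∃ A : ℕ, ∀ t : ℕ, (ClockedUA.pM Mt).eval t = A * t :=
    ⟨(ClockedUA.pM Mt).eval 1, fun t => by simp [ClockedUA.pM]⟩
  set K : ℕ := A * D + D with hKdef
  have hcK : c ≤ K := hcD.trans (Nat.le_add_left D (A * D))
  have hK1 : 1 ≤ K := by omega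
  have hbudget : ∀ n : ℕ, A * (D * n + D) ≤ K * n + K := by
    intro n
    have e : (A * D + D) * n + (A * D + D) = A * (D * n + D) + (D * n + D) := by ring
    rw [hKdef, e]
    exact Nat.le_add_right _ _
  -- (3) the reduction `x ↦ linInst Mt K x` is correct
  have hred : ∀ x : List Bool, x ∈ L ↔ linInst Mt K x ∈ Wlin := by
    intro x
    constructor
    · intro hx
      obtain ⟨y, hy, hRy⟩ := (hLR x).1 hx
      refine ⟨y, ?_, ?_⟩
      · rw [length_linInst]
        have : c * x.length ≤ K * x.length := Nat.mul_le_mul_right _ hcK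
        nlinarith [this, hy, hcK]
      · show relay3 (boolPair (boolPair (ClockedUA.code Mt)
          (boolPair x (List.replicate (K * x.length + K) true))) y) ∈ ClockedUA.U
        rw [relay3_apply]
        have hMy : Mt.OutputsWithin (boolPair x y) [true] (D * x.length + D) := by
          have h := hMt_short x y hy
          rwa [hRy] at h
        exact ClockedUA.complete Mt hMy (by rw [hA]; exact hbudget _)
    · rintro ⟨y, -, hq⟩
      have hq' : relay3 (boolPair (boolPair (ClockedUA.code Mt)
          (boolPair x (List.replicate (K * x.length + K) true))) y) ∈ ClockedUA.U := hq
      rw [relay3_apply] at hq'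
      obtain ⟨t, ht⟩ := ClockedUA.sound Mt hq'
      have heq := AvM.outputsWithin_unique Mt ht (hMt x y)
      have hR : R x (y.take (c * x.length + c)) = true := by
        have he : ∀ b : Bool, encodeBool b = [b] := fun b => rfl
        rw [he] at heq
        simpa using heq.symm
      exact (hLR x).2 ⟨y.take (c * x.length + c), List.length_take_le _ _, hR⟩
  -- (4) the decider: unary clock, constant prefix, decider of `Wlin`
  obtain ⟨NK, a', hNK⟩ := exists_linear_unaryClock hK1
  obtain ⟨Pf, hPf⟩ := exists_machine_prefix (boolPair (ClockedUA.code Mt) [])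
  obtain ⟨a₂, hdec⟩ := hW
  obtain ⟨MW, hMW⟩ := (hdec : TimeDecidable id Wlin fun n => a₂ * n ^ k + a₂)
  obtain ⟨C₁, hC₁⟩ := exists_affine_pow_le (K + 2) (2 * (ClockedUA.code Mt).length + 4 + K) k
  refine ⟨a' * K + a' + 6 * K + 2 * (ClockedUA.code Mt).length + 17 + 2 * (a₂ * C₁) + a₂,
    NK.comp (Pf.comp MW), fun x => ?_⟩
  simp only [id]
  have hind : Wlin.boolIndicator (linInst Mt K x) = L.boolIndicator x := by
    rw [Bool.eq_iff_iff]
    exact (Set.mem_iff_boolIndicator _ _).symm.trans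
      ((hred x).symm.trans (Set.mem_iff_boolIndicator _ _))
  have h1 := hNK x
  have h2 := hPf (boolPair x (List.replicate (K * x.length + K) true))
  rw [prefix_append_eq_linInst] at h2
  simp only [length_boolPair, List.length_replicate, List.length_nil, add_zero] at h2
  have h3 := hMW (linInst Mt K x)
  simp only [id] at h3
  rw [hind] at h3
  have h := Turing.TM2ComputableAux.comp_outputsWithin _ _ h1
    (Turing.TM2ComputableAux.comp_outputsWithin _ _ h2 h3)
  refine h.mono ?_
  have hP : (linInst Mt K x).length ^ k ≤ C₁ * x.length ^ k + C₁ := by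
    rw [length_linInst]
    exact hC₁ _
  exact ladder_arith_pos a' K (ClockedUA.code Mt).length a₂ C₁ k x.length _
    (Nat.one_le_iff_ne_zero.1 hk) hP

/-- **Each rung is witnessed by the same language**: for `k ≥ 1`,
`NTIME(n) ⊄ DTIME(nᵏ) → Wlin ∉ DTIME(nᵏ)`. [folklore] -/
theorem soloInformed_Wlin_not_mem_DTIME_pow_of_not_subset {k : ℕ} (hk : 1 ≤ k)
    (h : ¬ (NTIME (fun n => n) ⊆ DTIME (fun n => n ^ k))) : Wlin ∉ DTIME (fun n => n ^ k) :=
  fun hW => h (soloInformed_NTIME_id_subset_DTIME_pow_of_Wlin_mem_DTIME hk hW)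

/-- **The first rung on the fixed witness**: the Paul–Pippenger–Szemerédi–Trotter theorem
`NTIME(n) ⊄ DTIME(n)` (1983; vendored, unproved, as the named fact
`PaulEtAl1983_NTIME_not_subset_DTIME`) gives `Wlin ∉ DTIME(n)` — the explicit language is not
decidable in deterministic LINEAR time; `P ≠ NP` asks the same for every exponent.
[cite: PaulEtAl1983, main theorem] -/
theorem soloInformed_Wlin_not_mem_DTIME_id_of_paulEtAl1983
    (h : PaulEtAl1983_NTIME_not_subset_DTIME) : Wlin ∉ DTIME (fun n => n) := by
  intro hW
  have hW1 : Wlin ∈ DTIME (fun n => n ^ 1) := by simpa only [Nat.pow_one] using hW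
  have hsub := soloInformed_NTIME_id_subset_DTIME_pow_of_Wlin_mem_DTIME le_rfl hW1
  simp only [Nat.pow_one] at hsub
  exact h hsub

end Summit.PneNP.PneNP.Theorems
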